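import Literature.AlgebraicGeometry.AbelianSchemes.AbelianVarietyCechMulTwo
import Literature.Algebra.Homology.OrderedCechSystemRefineConst
import HarnessLib

/-!
# The inversion `[−1]` on ordered Čech classes of `𝒪_A`: the cover `U_i ∩ U_j ∩ [−1]⁻¹U_l`, the maps `[−1]^*`, `ref`,
# `(𝟙, [−1])^*`, and `[−1]^* = −1` on `Ȟ¹(A, 𝒪_A)` (Mumford AV §13 Cor. 2, `n_X^*` for `n = −1`)

Layer `Literature/AlgebraicGeometry/AbelianSchemes`; namespace `Literature.AlgebraicGeometry.AbelianSchemes.AbelianVarietyCech`.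
DEFINITION file (reducible abbreviations naming maps built from ★ data, and theorems; no instance, no notation, no named fact,
no `sorry`).  Twin of ★ `AbelianVarietyCechDiagonalMaps` ∕ ★ `AbelianVarietyCechMulTwo` (which treat `[2] = Δ ≫ m` on the diagonal
cover) for the INVERSION `ι = [−1]` of the abelian variety `A` over a field `k` and the ANTIDIAGONAL `δ = (𝟙, ι) : A → A × A`
(`δ ≫ p₁ = 𝟙`, `δ ≫ p₂ = ι`, `δ ≫ m = ε := toUnit ≫ e`, Mathlib `GrpObj.right_inv`).  Everything over ★ `AbelianVarietyCechProductMaps`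
(the covers `U`, `W₀`, `W`, the complexes `CA CS CT`, the maps `pOne pTwo mT rT mS`, the index `j₀` with `e⁻¹U_{j₀} = ⊤`).

The INVERSION COVER attached to a finite affine cover `U` is a binder `WI : (ι' ×ₗ ι') ×ₗ ι' → A.X.left.affineOpens` with shape
`hWI : WI ((i, j), l) = U_i ∩ U_j ∩ ι⁻¹ U_l` (the shape consumed by ★ N4 `CechMH2.mk_refineC2_comapC2_eq_smul_of_ordered` at `g := ι`;
`exists_invCover`, `iSup_invCover_eq_top`).  On it we read `invI = ι^* : Ȟ(U) → Ȟ(WI)` (index map `((i,j),l) ↦ l`), the refinement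
`refI : Ȟ(U) → Ȟ(WI)` (index map `((i,j),l) ↦ i`), `δ₀I = δ^* : Ȟ(W₀) → Ȟ(WI)` (index map `((i,j),l) ↦ (i,l)`) and
`δI = δ^* : Ȟ(W) → Ȟ(WI)` (index map `((i,j),l) ↦ ((i,l), j₀)`), and prove:
* §1 `adiag_p₁`, `adiag_p₂`, **`adiag_m : δ ≫ m = ε`**, `cst_eq`, base rings; §2 the inversion cover and the admissibilities;
* §3 the composites **`δ₀I_pOne : δ^* p₁^* = ref`**, **`δ₀I_pTwo : δ^* p₂^* = ι^*`**, **`δI_rT : δ^* r^* = δ^*`**,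
  **`δI_mT : δ^* m_T^* = 0` in degrees `≥ 1`** (`δ ≫ m = ε` is CONSTANT: constant index map `j₀`, ★ `homologyMap_eq_zero_of_refine_const`);
* §4 **`invI_degree_one : ι^* a = − ref a` on `Ȟ¹(U, 𝒪_A)`** — primitivity ★ `mS_degree_one` (`m^* a = p₁^* a + p₂^* a`) pulled back
  along `δ`; any characteristic;
* §5 `invI_mul`, `refI_mul` (multiplicativity on classes, ★ `homologyMap_pullback_cupH`).
Sequel `AbelianVarietyCechInversionH2`: `ι^* = +1` on `Ȟ²(U, 𝒪_A)` from `Ȟ¹ ∪ Ȟ¹ = Ȟ²`, and the raw module Čech transport (N4).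
Cell `hodgecm-mathlib` (D-0151), FLOOR 0 ∕ P6 (U)-road organ (O4) «`[−1]^*` on `Ȟ•(𝒪)`» (census LA3-p01 (g5) ∕ A-p12); generic,
count-neutral — HC_CM is proved only modulo the 7 printed citations until rung 0 closes, and nothing here refers to it.

## References
* D. Mumford, *Abelian Varieties* (1970), §13 Cor. 2 (p. 129) and its proof (`n_X^*` on `H¹`, `H^p = Λ^p H¹`). [MumfordAV1970]
* The Stacks Project, Tag 01FP (functoriality and index-map independence of Čech cohomology), Tag 01FG. [StacksProject]
* F. Oort, *Finite group schemes, local moduli for abelian varieties, and lifting problems*, Compositio Math. 23 (1971), proof of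
  Thm. (2.2.1), pp. 279–280 (`[−1]` acts by `−1` on the tangent data and trivially on the lifting problem). [Oort1971]
-/

noncomputable section

open CategoryTheory CategoryTheory.Limits CategoryTheory.MonoidalCategory AlgebraicGeometry TopologicalSpace Opposite
open HomologicalComplex TensorProduct Finset
open Literature.Algebra.Homology Literature.Algebra.Homology.OrderedCech Literature.AlgebraicGeometry.Modules
open Literature.AlgebraicGeometry.Morphisms

set_option backward.isDefEq.respectTransparency false

namespace Literature.AlgebraicGeometry.AbelianSchemes.AbelianVarietyCech

universe u

section Inversion

variable {k : Type} [Field k] (A : AbelianSchemeOver (Spec (.of k)))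
  {ι : Type} [LinearOrder ι] [Fintype ι] (U : ι → A.X.left.affineOpens) (hcov : ⨆ i, (U i).1 = ⊤)
  (W₀ : ι ×ₗ ι → (X2 A).affineOpens)
  (hW₀ : ∀ i j, (W₀ (toLex (i, j))).1 = p₁ A ⁻¹ᵁ (U i).1 ⊓ p₂ A ⁻¹ᵁ (U j).1)
  (W : (ι ×ₗ ι) ×ₗ ι → (X2 A).affineOpens)
  (hW : ∀ c l, (W (toLex (c, l))).1 = (W₀ c).1 ⊓ m A ⁻¹ᵁ (U l).1)
  (j₀ : ι) (hj₀ : e A ⁻¹ᵁ (U j₀).1 = ⊤)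

/-! ## §1 The inversion, the antidiagonal, the constant map -/

/-- the inversion `ι = [−1] : X → X`. [cite: MumfordAV1970, §13 Cor. 2 (p. 129)] -/
abbrev inv : A.X.left ⟶ A.X.left := (GrpObj.inv : A.X ⟶ A.X).left
/-- the antidiagonal `δ = (𝟙, ι) : X → X × X`. [cite: MumfordAV1970, §13 Cor. 2 (p. 129)] -/
abbrev adiag : A.X.left ⟶ X2 A := (CartesianMonoidalCategory.lift (𝟙 A.X) (GrpObj.inv : A.X ⟶ A.X)).left
/-- the constant map at the identity `ε = toUnit ≫ e : X → X`. [cite: MumfordAV1970, §13 Cor. 2 (p. 129)] -/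
abbrev cst : A.X.left ⟶ A.X.left := (CartesianMonoidalCategory.toUnit A.X ≫ (MonObj.one : 𝟙_ _ ⟶ A.X)).left

omit [LinearOrder ι] [Fintype ι] in
/-- `δ ≫ p₁ = 𝟙`. [cite: MumfordAV1970, §13 Cor. 2 (p. 129)] -/
theorem adiag_p₁ : adiag A ≫ p₁ A = 𝟙 _ := by
  rw [← Over.comp_left, CartesianMonoidalCategory.lift_fst]
  rfl

omit [LinearOrder ι] [Fintype ι] in
/-- `δ ≫ p₂ = ι`. [cite: MumfordAV1970, §13 Cor. 2 (p. 129)] -/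
theorem adiag_p₂ : adiag A ≫ p₂ A = inv A := by
  rw [← Over.comp_left, CartesianMonoidalCategory.lift_snd]

omit [LinearOrder ι] [Fintype ι] in
/-- `δ ≫ m = ε`: `(𝟙, ι) ≫ μ = toUnit ≫ η` (Mathlib `GrpObj.right_inv`). [cite: MumfordAV1970, §13 Cor. 2 (p. 129)] -/
theorem adiag_m : adiag A ≫ m A = cst A := by
  rw [← Over.comp_left, GrpObj.right_inv]

omit [LinearOrder ι] [Fintype ι] in
/-- `ε = toUnit ≫ e` on underlying schemes. [cite: MumfordAV1970, §13 Cor. 2 (p. 129)] -/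
theorem cst_eq : cst A = (CartesianMonoidalCategory.toUnit A.X).left ≫ e A := by
  rw [← Over.comp_left]

omit [LinearOrder ι] [Fintype ι] in
include hj₀ in
/-- `ε⁻¹ U_{j₀} = X` (the identity point lies in `U_{j₀}`). [cite: StacksProject, Tag 01FP] -/
theorem preimage_cst_eq_top : cst A ⁻¹ᵁ (U j₀).1 = ⊤ := by
  refine top_le_iff.mp fun x _ => ?_
  rw [← AbelianSchemeOver.mem_preimage_of_comp_eq (cst_eq A).symm (U j₀).1 x]
  change (CartesianMonoidalCategory.toUnit A.X).left.base x ∈ e A ⁻¹ᵁ (U j₀).1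
  rw [hj₀]
  trivial

omit [LinearOrder ι] [Fintype ι] in
/-- Base rings along `ι`. [cite: StacksProject, Tag 01FP] -/
theorem hρ_inv (a : k) : ρ₁ A a = (inv A).appTop (ρ₁ A a) := scalarRingHomTop_over (GrpObj.inv : A.X ⟶ A.X) a

omit [LinearOrder ι] [Fintype ι] in
/-- Base rings along `δ`. [cite: StacksProject, Tag 01FP] -/
theorem hρ_adiag (a : k) : ρ₁ A a = (adiag A).appTop (ρ₂ A a) :=
  scalarRingHomTop_over (CartesianMonoidalCategory.lift (𝟙 A.X) (GrpObj.inv : A.X ⟶ A.X)) a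

/-! ## §2 The inversion cover `WI ((i, j), l) = U_i ∩ U_j ∩ ι⁻¹ U_l` and the admissibilities -/

omit [Fintype ι] in
/-- **The inversion cover exists** as a family of affine opens (`X` separated over `k`, ★ `isAffineOpen_inf_preimage`).
[cite: StacksProject, Tag 01FP] -/
theorem exists_invCover : ∃ WI : (ι ×ₗ ι) ×ₗ ι → A.X.left.affineOpens,
    ∀ i j l, (WI (toLex (toLex (i, j), l))).1 = (U i).1 ⊓ (U j).1 ⊓ inv A ⁻¹ᵁ (U l).1 := by
  classical
  haveI : IsSeparated A.X.hom := A.isProper.toIsSeparated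
  haveI := isSeparated_X A
  have hij : ∀ i j : ι, IsAffineOpen ((U i).1 ⊓ (U j).1) := fun i j => by
    have h := isAffineOpen_cechOpen_of_nonempty U (s := {i, j}) ⟨i, Finset.mem_insert_self _ _⟩
    rwa [cechOpen_pair] at h
  exact ⟨fun d => ⟨_, isAffineOpen_inf_preimage (Z := A.X) (inv A) (hij (ofLex (ofLex d).1).1 (ofLex (ofLex d).1).2)
    (U (ofLex d).2)⟩, fun _ _ _ => rfl⟩

variable (WI : (ι ×ₗ ι) ×ₗ ι → A.X.left.affineOpens)
  (hWI : ∀ i j l, (WI (toLex (toLex (i, j), l))).1 = (U i).1 ⊓ (U j).1 ⊓ inv A ⁻¹ᵁ (U l).1)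

/-- The inversion cover as a family of opens. [cite: StacksProject, Tag 01FP] -/
abbrev WI' : (ι ×ₗ ι) ×ₗ ι → A.X.left.Opens := fun d => (WI d).1

omit [LinearOrder ι] [Fintype ι] in
include hWI in
/-- The inversion cover read on a general index. [cite: StacksProject, Tag 01FP] -/
theorem invCover_eq (d : (ι ×ₗ ι) ×ₗ ι) :
    WI' A WI d = (U (ofLex (ofLex d).1).1).1 ⊓ (U (ofLex (ofLex d).1).2).1 ⊓ inv A ⁻¹ᵁ (U (ofLex d).2).1 := by
  obtain ⟨c, l⟩ := d
  obtain ⟨i, j⟩ := c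
  exact hWI i j l

omit [LinearOrder ι] [Fintype ι] in
include hWI in
/-- `θ_ι ((i, j), l) = l` is admissible: `WI ((i, j), l) ⊆ ι⁻¹ U_l`. [cite: StacksProject, Tag 01FP] -/
theorem adm_inv (d : (ι ×ₗ ι) ×ₗ ι) : WI' A WI d ≤ inv A ⁻¹ᵁ U' A U (ofLex d).2 := by
  rw [invCover_eq A U WI hWI]
  exact inf_le_right

omit [LinearOrder ι] [Fintype ι] in
include hWI in
/-- `((i, j), l) ↦ i` is admissible for the refinement `WI → U`. [cite: StacksProject, Tag 01FP] -/
theorem adm_refI (d : (ι ×ₗ ι) ×ₗ ι) : WI' A WI d ≤ (𝟙 A.X.left : A.X.left ⟶ A.X.left) ⁻¹ᵁ U' A U (ofLex (ofLex d).1).1 := by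
  rw [invCover_eq A U WI hWI]
  exact inf_le_left.trans inf_le_left

omit [LinearOrder ι] [Fintype ι] in
include hW₀ hWI in
/-- `WI ((i, j), l) ⊆ δ⁻¹ W₀ (i, l)` (`δ ≫ p₁ = 𝟙`, `δ ≫ p₂ = ι`). [cite: StacksProject, Tag 01FP] -/
theorem adm_adiag₀ (d : (ι ×ₗ ι) ×ₗ ι) :
    WI' A WI d ≤ adiag A ⁻¹ᵁ W₀' A W₀ (toLex ((ofLex (ofLex d).1).1, (ofLex d).2)) := by
  obtain ⟨c, l⟩ := d
  obtain ⟨i, j⟩ := c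
  change (WI (toLex (toLex (i, j), l))).1 ≤ adiag A ⁻¹ᵁ (W₀ (toLex (i, l))).1
  rw [hWI, hW₀]
  intro x hx
  change (adiag A).base x ∈ p₁ A ⁻¹ᵁ (U i).1 ⊓ p₂ A ⁻¹ᵁ (U l).1
  refine ⟨?_, ?_⟩
  · change (p₁ A).base ((adiag A).base x) ∈ (U i).1
    rw [AbelianSchemeOver.mem_preimage_of_comp_eq (adiag_p₁ A) (U i).1 x]
    exact hx.1.1
  · change (p₂ A).base ((adiag A).base x) ∈ (U l).1
    rw [AbelianSchemeOver.mem_preimage_of_comp_eq (adiag_p₂ A) (U l).1 x]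
    exact hx.2

omit [LinearOrder ι] [Fintype ι] in
include hW₀ hW hj₀ hWI in
/-- `WI ((i, j), l) ⊆ δ⁻¹ W ((i, l), j₀)` (`δ ≫ m = ε` and `ε⁻¹ U_{j₀} = X`). [cite: StacksProject, Tag 01FP] -/
theorem adm_adiagT (d : (ι ×ₗ ι) ×ₗ ι) :
    WI' A WI d ≤ adiag A ⁻¹ᵁ W' A W (toLex (toLex ((ofLex (ofLex d).1).1, (ofLex d).2), j₀)) := by
  obtain ⟨c, l⟩ := d
  obtain ⟨i, j⟩ := c
  change (WI (toLex (toLex (i, j), l))).1 ≤ adiag A ⁻¹ᵁ (W (toLex (toLex (i, l), j₀))).1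
  rw [hWI, hW, hW₀]
  intro x hx
  change (adiag A).base x ∈ (p₁ A ⁻¹ᵁ (U i).1 ⊓ p₂ A ⁻¹ᵁ (U l).1) ⊓ m A ⁻¹ᵁ (U j₀).1
  refine ⟨⟨?_, ?_⟩, ?_⟩
  · change (p₁ A).base ((adiag A).base x) ∈ (U i).1
    rw [AbelianSchemeOver.mem_preimage_of_comp_eq (adiag_p₁ A) (U i).1 x]
    exact hx.1.1
  · change (p₂ A).base ((adiag A).base x) ∈ (U l).1
    rw [AbelianSchemeOver.mem_preimage_of_comp_eq (adiag_p₂ A) (U l).1 x]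
    exact hx.2
  · change (m A).base ((adiag A).base x) ∈ (U j₀).1
    rw [AbelianSchemeOver.mem_preimage_of_comp_eq (adiag_m A) (U j₀).1 x, preimage_cst_eq_top A U j₀ hj₀]
    trivial

omit [LinearOrder ι] [Fintype ι] in
include hcov hWI in
/-- **The inversion cover covers `X`**: `x ∈ U_i` and `ι x ∈ U_l` give `x ∈ WI ((i, i), l)`. [cite: StacksProject, Tag 01FP] -/
theorem iSup_invCover_eq_top : ⨆ d, WI' A WI d = ⊤ := by
  refine top_le_iff.mp fun x _ => ?_
  have hx : x ∈ (⊤ : A.X.left.Opens) := trivial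
  have hy : (inv A).base x ∈ (⊤ : A.X.left.Opens) := trivial
  rw [← hcov] at hx hy
  obtain ⟨i, hi⟩ := Opens.mem_iSup.mp hx
  obtain ⟨l, hl⟩ := Opens.mem_iSup.mp hy
  refine Opens.mem_iSup.mpr ⟨toLex (toLex (i, i), l), ?_⟩
  change x ∈ (WI (toLex (toLex (i, i), l))).1
  rw [hWI]
  exact ⟨⟨hi, hi⟩, hl⟩

/-! ### The Čech data on the inversion cover -/

/-- `Č(WI, 𝒪_X)`. [cite: MumfordAV1970, §13 Cor. 2 (p. 129)] -/
abbrev CI := cechComplex (WI' A WI) (unitModule A.X.left) (ρ₁ A)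
/-- cup product on `Ȟ(WI, 𝒪_X)`. [cite: MumfordAV1970, §13 Cor. 2 (p. 129)] -/
abbrev cupI (a b n : ℕ) (h : a + b = n) :=
  cupH (mulPairing (WI' A WI) (ρ₁ A)) (isNaturalPairing_mulPairing _ _) a b n h

/-- `φ_ι` (index map `((i, j), l) ↦ l`). [cite: StacksProject, Tag 01FP] -/
abbrev φinv := pullbackSystemHom (inv A) (U' A U) (WI' A WI) (fun d => (ofLex d).2) (adm_inv A U WI hWI) (ρ₁ A) (ρ₁ A)
  (hρ_inv A)
/-- `φ_{ref}` (refinement `WI → U` along `((i, j), l) ↦ i`). [cite: StacksProject, Tag 01FP] -/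
abbrev φrefI := pullbackSystemHom (𝟙 A.X.left) (U' A U) (WI' A WI) (fun d => (ofLex (ofLex d).1).1)
  (adm_refI A U WI hWI) (ρ₁ A) (ρ₁ A) (hρ_one A)
/-- `φ_δ` from the product cover (index map `((i, j), l) ↦ (i, l)`). [cite: StacksProject, Tag 01FP] -/
abbrev φadiag₀ := pullbackSystemHom (adiag A) (W₀' A W₀) (WI' A WI) (fun d => toLex ((ofLex (ofLex d).1).1, (ofLex d).2))
  (adm_adiag₀ A U W₀ hW₀ WI hWI) (ρ₂ A) (ρ₁ A) (hρ_adiag A)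
/-- `φ_δ` from the triple cover (index map `((i, j), l) ↦ ((i, l), j₀)`). [cite: StacksProject, Tag 01FP] -/
abbrev φadiagT := pullbackSystemHom (adiag A) (W' A W) (WI' A WI)
  (fun d => toLex (toLex ((ofLex (ofLex d).1).1, (ofLex d).2), j₀))
  (adm_adiagT A U W₀ hW₀ W hW j₀ hj₀ WI hWI) (ρ₂ A) (ρ₁ A) (hρ_adiag A)

/-- `ι^* : Ȟ(U) → Ȟ(WI)` along `((i, j), l) ↦ l`. [cite: MumfordAV1970, §13 Cor. 2 (p. 129)] -/
abbrev invI (n : ℕ) : (CA A U).homology (n : ℤ) →ₗ[k] (CI A WI).homology (n : ℤ) :=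
  (HomologicalComplex.homologyMap (refineComplexMap (fun d => (ofLex d).2) (φinv A U WI hWI)) (n : ℤ)).hom
/-- `ref : Ȟ(U) → Ȟ(WI)` along `((i, j), l) ↦ i`. [cite: MumfordAV1970, §13 Cor. 2 (p. 129)] -/
abbrev refI (n : ℕ) : (CA A U).homology (n : ℤ) →ₗ[k] (CI A WI).homology (n : ℤ) :=
  (HomologicalComplex.homologyMap (refineComplexMap (fun d => (ofLex (ofLex d).1).1) (φrefI A U WI hWI)) (n : ℤ)).hom
/-- `δ^* : Ȟ(W₀) → Ȟ(WI)` along `((i, j), l) ↦ (i, l)`. [cite: MumfordAV1970, §13 Cor. 2 (p. 129)] -/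
abbrev δ₀I (n : ℕ) : (CS A W₀).homology (n : ℤ) →ₗ[k] (CI A WI).homology (n : ℤ) :=
  (HomologicalComplex.homologyMap
    (refineComplexMap (fun d => toLex ((ofLex (ofLex d).1).1, (ofLex d).2)) (φadiag₀ A U W₀ hW₀ WI hWI)) (n : ℤ)).hom
/-- `δ^* : Ȟ(W) → Ȟ(WI)` along `((i, j), l) ↦ ((i, l), j₀)`. [cite: MumfordAV1970, §13 Cor. 2 (p. 129)] -/
abbrev δI (n : ℕ) : (CT A W).homology (n : ℤ) →ₗ[k] (CI A WI).homology (n : ℤ) :=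
  (HomologicalComplex.homologyMap
    (refineComplexMap (fun d => toLex (toLex ((ofLex (ofLex d).1).1, (ofLex d).2), j₀))
      (φadiagT A U W₀ hW₀ W hW j₀ hj₀ WI hWI)) (n : ℤ)).hom

/-! ## §3 The composites `δ^* p₁^* = ref`, `δ^* p₂^* = ι^*`, `δ^* r^* = δ^*`, `δ^* m_T^* = 0` -/

omit [Fintype ι] in
include hW₀ in
/-- `δ^* ∘ p₁^* = ref` (`δ ≫ p₁ = 𝟙`, composite index map `((i,j),l) ↦ i`). [cite: StacksProject, Tag 01FP] -/
theorem δ₀I_pOne (n : ℕ) (y : (CA A U).homology (n : ℤ)) :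
    δ₀I A U W₀ hW₀ WI hWI n (pOne A U W₀ hW₀ n y) = refI A U WI hWI n y := by
  rw [homologyMap_comp_apply]
  have hadm := adm_comp _ _ _ _ _ _ _ (AbelianSchemeOver.productCover_le_preimage_fst A (U' A U) (W₀' A W₀) hW₀)
    (adm_adiag₀ A U W₀ hW₀ WI hWI)
  have hρc := hρ_comp _ _ (ρ₁ A) (ρ₂ A) (ρ₁ A) (hρ_p₁ A) (hρ_adiag A)
  have hF : refineComplexMap _ (φp₁ A U W₀ hW₀) ≫ refineComplexMap _ (φadiag₀ A U W₀ hW₀ WI hWI) =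
      refineComplexMap _ (φrefI A U WI hWI) := by
    refine hom_ext_apply fun m' g => ?_
    change refineCochain _ (φadiag₀ A U W₀ hW₀ WI hWI) m' (refineCochain _ (φp₁ A U W₀ hW₀) m' g) =
      refineCochain _ (φrefI A U WI hWI) m' g
    rw [refineCochain_comp _ _ _ _ (pullbackSystemHom (adiag A ≫ p₁ A) (U' A U) (WI' A WI) _ hadm (ρ₁ A) (ρ₁ A) hρc)
        (pullbackSystemHom_comp_app _ _ _ _ _ _ _ _ _ _ _ _ _ _ _ _)]
    funext σ'
    rw [refineCochain_apply, refineCochain_apply]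
    exact pullbackSystemHom_congr (adiag_p₁ A) (U' A U) (WI' A WI) _ hadm (adm_refI A U WI hWI) (ρ₁ A) (ρ₁ A) hρc
      (hρ_one A) σ'.1 _
  rw [hF]

omit [Fintype ι] in
include hW₀ in
/-- `δ^* ∘ p₂^* = ι^*` (`δ ≫ p₂ = ι`, composite index map `((i,j),l) ↦ l`). [cite: StacksProject, Tag 01FP] -/
theorem δ₀I_pTwo (n : ℕ) (y : (CA A U).homology (n : ℤ)) :
    δ₀I A U W₀ hW₀ WI hWI n (pTwo A U W₀ hW₀ n y) = invI A U WI hWI n y := by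
  rw [homologyMap_comp_apply]
  have hadm := adm_comp _ _ _ _ _ _ _ (AbelianSchemeOver.productCover_le_preimage_snd A (U' A U) (W₀' A W₀) hW₀)
    (adm_adiag₀ A U W₀ hW₀ WI hWI)
  have hρc := hρ_comp _ _ (ρ₁ A) (ρ₂ A) (ρ₁ A) (hρ_p₂ A) (hρ_adiag A)
  have hF : refineComplexMap _ (φp₂ A U W₀ hW₀) ≫ refineComplexMap _ (φadiag₀ A U W₀ hW₀ WI hWI) =
      refineComplexMap _ (φinv A U WI hWI) := by
    refine hom_ext_apply fun m' g => ?_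
    change refineCochain _ (φadiag₀ A U W₀ hW₀ WI hWI) m' (refineCochain _ (φp₂ A U W₀ hW₀) m' g) =
      refineCochain _ (φinv A U WI hWI) m' g
    rw [refineCochain_comp _ _ _ _ (pullbackSystemHom (adiag A ≫ p₂ A) (U' A U) (WI' A WI) _ hadm (ρ₁ A) (ρ₁ A) hρc)
        (pullbackSystemHom_comp_app _ _ _ _ _ _ _ _ _ _ _ _ _ _ _ _)]
    funext σ'
    rw [refineCochain_apply, refineCochain_apply]
    exact pullbackSystemHom_congr (adiag_p₂ A) (U' A U) (WI' A WI) _ hadm (adm_inv A U WI hWI) (ρ₁ A) (ρ₁ A) hρc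
      (hρ_inv A) σ'.1 _
  rw [hF]

omit [Fintype ι] in
include hW₀ in
/-- `δ^* ∘ r^* = δ^*` from the triple to the product cover (`δ ≫ 𝟙 = δ`, composite index map `((i,j),l) ↦ (i,l)`).
[cite: StacksProject, Tag 01FP] -/
theorem δI_rT (n : ℕ) (Y : (CS A W₀).homology (n : ℤ)) :
    δI A U W₀ hW₀ W hW j₀ hj₀ WI hWI n (rT A U W₀ W hW n Y) = δ₀I A U W₀ hW₀ WI hWI n Y := by
  rw [homologyMap_comp_apply]
  have hadm := adm_comp _ _ _ _ _ _ _ (AbelianSchemeOver.refinedCover_le_productCover A (U' A U) (W₀' A W₀) (W' A W) hW)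
    (adm_adiagT A U W₀ hW₀ W hW j₀ hj₀ WI hWI)
  have hρc := hρ_comp _ _ (ρ₂ A) (ρ₂ A) (ρ₁ A) (hρ_r A) (hρ_adiag A)
  have hF : refineComplexMap _ (φr A U W₀ W hW) ≫ refineComplexMap _ (φadiagT A U W₀ hW₀ W hW j₀ hj₀ WI hWI) =
      refineComplexMap _ (φadiag₀ A U W₀ hW₀ WI hWI) := by
    refine hom_ext_apply fun m' g => ?_
    change refineCochain _ (φadiagT A U W₀ hW₀ W hW j₀ hj₀ WI hWI) m' (refineCochain _ (φr A U W₀ W hW) m' g) =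
      refineCochain _ (φadiag₀ A U W₀ hW₀ WI hWI) m' g
    rw [refineCochain_comp _ _ _ _ (pullbackSystemHom (adiag A ≫ 𝟙 _) (W₀' A W₀) (WI' A WI) _ hadm (ρ₂ A) (ρ₁ A) hρc)
        (pullbackSystemHom_comp_app _ _ _ _ _ _ _ _ _ _ _ _ _ _ _ _)]
    funext σ'
    rw [refineCochain_apply, refineCochain_apply]
    exact pullbackSystemHom_congr (Category.comp_id _) (W₀' A W₀) (WI' A WI) _ hadm (adm_adiag₀ A U W₀ hW₀ WI hWI)
      (ρ₂ A) (ρ₁ A) hρc (hρ_adiag A) σ'.1 _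
  rw [hF]

omit [Fintype ι] in
include hW₀ in
/-- **`δ^* ∘ m_T^* = 0` on `Ȟ^{≥ 1}`**: `δ ≫ m = ε` is the CONSTANT map at the identity, and the composite index map
`((i,j),l) ↦ j₀` is constant (★ `homologyMap_eq_zero_of_refine_const`). [cite: StacksProject, Tag 01FP] [cite: MumfordAV1970, §13 Cor. 2 (p. 129)] -/
theorem δI_mT (n : ℕ) (hn : 1 ≤ n) (y : (CA A U).homology (n : ℤ)) :
    δI A U W₀ hW₀ W hW j₀ hj₀ WI hWI n (mT A U W₀ W hW n y) = 0 := by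
  rw [homologyMap_comp_apply]
  have hadm := adm_comp _ _ _ _ _ _ _ (AbelianSchemeOver.refinedCover_le_preimage_mul A (U' A U) (W₀' A W₀) (W' A W) hW)
    (adm_adiagT A U W₀ hW₀ W hW j₀ hj₀ WI hWI)
  have hρc := hρ_comp _ _ (ρ₁ A) (ρ₂ A) (ρ₁ A) (hρ_m A) (hρ_adiag A)
  have hF := homologyMap_eq_zero_of_refine_const j₀
    (pullbackSystemHom (adiag A ≫ m A) (U' A U) (WI' A WI) _ hadm (ρ₁ A) (ρ₁ A) hρc)
    (refineComplexMap _ (φm A U W₀ W hW) ≫ refineComplexMap _ (φadiagT A U W₀ hW₀ W hW j₀ hj₀ WI hWI)) (n := (n : ℤ))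
    (by exact_mod_cast hn) (fun g => by
      change refineCochain _ (φadiagT A U W₀ hW₀ W hW j₀ hj₀ WI hWI) _ (refineCochain _ (φm A U W₀ W hW) _ g) = _
      rw [refineCochain_comp _ _ _ _ (pullbackSystemHom (adiag A ≫ m A) (U' A U) (WI' A WI) _ hadm (ρ₁ A) (ρ₁ A) hρc)
        (pullbackSystemHom_comp_app _ _ _ _ _ _ _ _ _ _ _ _ _ _ _ _)]
      rfl)
  rw [hF]
  rfl

/-! ## §4 `ι^* = −1` on `Ȟ¹(U, 𝒪_A)` -/

include hcov hW₀ hW hj₀ in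
/-- **`ι^* a = − ref a` on `Ȟ¹(U, 𝒪_A)`**, read on the inversion cover: pull the primitivity `m^* a = p₁^* a + p₂^* a` (★ `mS_degree_one`)
back along the antidiagonal `δ = (𝟙, ι)`: `δ^* m^* a = ε^* a = 0` (§3), `δ^* p₁^* a = ref a`, `δ^* p₂^* a = ι^* a`.  Any characteristic.
[cite: MumfordAV1970, §13 Cor. 2 (p. 129)] [cite: Oort1971, proof of Thm. (2.2.1), pp. 279–280] -/
theorem invI_degree_one (a : (CA A U).homology ((1 : ℕ) : ℤ)) :
    invI A U WI hWI 1 a = -refI A U WI hWI 1 a := by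
  have hr : rT A U W₀ W hW 1 (mS A U hcov W₀ hW₀ W hW 1 a) = mT A U W₀ W hW 1 a :=
    (LinearEquiv.ofBijective (rT A U W₀ W hW 1) (rT_bijective A U hcov W₀ hW₀ W hW 1)).apply_symm_apply _
  have h0 : δ₀I A U W₀ hW₀ WI hWI 1 (mS A U hcov W₀ hW₀ W hW 1 a) = 0 := by
    rw [← δI_rT A U W₀ hW₀ W hW j₀ hj₀ WI hWI, hr, δI_mT A U W₀ hW₀ W hW j₀ hj₀ WI hWI 1 le_rfl]
  rw [mS_degree_one A U hcov W₀ hW₀ W hW j₀ hj₀, map_add, δ₀I_pOne A U W₀ hW₀ WI hWI, δ₀I_pTwo A U W₀ hW₀ WI hWI] at h0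
  exact eq_neg_of_add_eq_zero_right h0

/-! ## §5 Multiplicativity of `ι^*` and of `ref` on classes -/

include hcov in
/-- `ι^*` is multiplicative on classes (NON-monotone index map; ★ `homologyMap_pullback_cupH`). [cite: StacksProject, Tag 01FP] -/
theorem invI_mul (a b n : ℕ) (h : a + b = n) (y : (CA A U).homology (a : ℤ)) (z : (CA A U).homology (b : ℤ)) :
    invI A U WI hWI n (cupA A U a b n h y z) = cupI A WI a b n h (invI A U WI hWI a y) (invI A U WI hWI b z) :=
  homologyMap_pullback_cupH _ _ _ _ _ _ _ _ (hUa A U) hcov a b n h y z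

include hcov in
/-- `ref` is multiplicative on classes. [cite: StacksProject, Tag 01FP] -/
theorem refI_mul (a b n : ℕ) (h : a + b = n) (y : (CA A U).homology (a : ℤ)) (z : (CA A U).homology (b : ℤ)) :
    refI A U WI hWI n (cupA A U a b n h y z) = cupI A WI a b n h (refI A U WI hWI a y) (refI A U WI hWI b z) :=
  homologyMap_pullback_cupH _ _ _ _ _ _ _ _ (hUa A U) hcov a b n h y z

end Inversion

end Literature.AlgebraicGeometry.AbelianSchemes.AbelianVarietyCech

end
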